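import Literature.MathematicalPhysics.QuantumLattice.DWaveSourceFreePressure
import Literature.MathematicalPhysics.QuantumLattice.DWaveSourceFreeGainBound
import Literature.MathematicalPhysics.QuantumLattice.TorusCooperSumLogBound
import Literature.MathematicalPhysics.QuantumLattice.TorusCooperSumTemperatureWalk
import Summits.HubbardSuperconductivity.HubbardSuperconductivity.Theorems.TwSourcedCondensation.Negative.SourceResponseStructure

/-!
# Route `ThermalWedge`, crux `TwSourcedCondensation` (item `stmt-HubbardSuperconductivity-1697`):
# the free linear-regime Cooper logarithm (stub (F) of line `entropy-staircase-linear-regime`)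

For the `U = 0` Hubbard torus with the uniform `d_{x²-y²}` pair source `-h(Δ_d + Δ_d†)`
(`dWaveSourceTorus L 0 μ h`) we PROVE the LOWER Cooper-logarithmic bound on the sourced pressure gain
on the linear window `|h| ≤ 1/β`: for every compact `[μ₁, μ₂] ⊂ (-4, 0)` there are `c₀, C₀ > 0` with

  `c₀ h² log β - C₀ h² ≤ p̃_L(β,0,μ,h) - p̃_L(β,0,μ,0)`,  `p̃_L = log Re Z_β(dWaveSourceTorus L 0 μ ·)/(βL²)`,

for all `β ≥ 1`, `μ ∈ [μ₁, μ₂]`, eventually in `L` (threshold depending on `β`) and all `|h| ≤ 1/β`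
(`stub_freeLinearCooperLog`, registered signature of the skeleton
`Lines/entropy-staircase-linear-regime.lean` of the crux). It is the lower twin of
`dWaveSource_free_sourcedGain_le` (`DWaveSourceFreeGainBound.lean`).

Proof. By the BdG formula (`log_partitionFn_dWaveSourceTorus_zero_sub`) the gain is
`Σ_k [log((1+cosh βE_k)/2) - log((1+cosh βξ_k)/2)]`, `E_k² = ξ_k² + 8h²ĝ_d(k)²`; every mode gains
(`bdgModeGain_nonneg`) and a mode with `|ξ_k| ≥ 1/β` gains `≥ βh²ĝ_d(k)²/(5|ξ_k|)` (`bdgModeGain_ge`,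
real-analysis lemmas in `Literature/MathematicalPhysics/QuantumLattice/TorusCooperSumTemperatureWalk.lean`).
On a row `k₂ = b` crossing the Fermi level transversally with `d`-wave margin
(`card_cooperGoodRows_dWave_ge`: `≳ L` such rows) the form factor is `ĝ_d = c_b + μ/2 - ξ/2`, bounded
below near the crossing, and the harmonic walk at cutoff `1/β` (`cooperRow_weighted_sum_ge`) gives
`Σ 1/ξ ≳ L(log β - C)`; in total `≳ βL²h²(log β - C)` for `β ≥ β⋆(μ₁,μ₂)`. For `β < β⋆` the response is
`≥ 0` (`pressure_response_nonneg`, Peierls–Bogoliubov) and `c₀ log β ≤ C₀`. Constants: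
`s = min(μ₁+4,-μ₂)/4`, `c₀ = s³/(1280π²)`, `C₀ = c₀ log(128/s³)`, `L₀ = max(⌈400/s²⌉, ⌈β⌉)`.

Sources: M. Salmhofer, *Renormalization* (1999) §4.5.4 (the Cooper logarithm `½N(0) log β`);
J. Bardeen, L. N. Cooper, J. R. Schrieffer, Phys. Rev. 108 (1957) 1175 §III (BdG free energy). No
definition, no named fact.
-/

noncomputable section

namespace Summit.HubbardSuperconductivity.HubbardSuperconductivity.Theorems

open Matrix Finset Real Literature.MathematicalPhysics.QuantumLattice Literature.Probability.LatticeModels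

section Geometry

variable {L : ℕ} [NeZero L]

omit [NeZero L] in
/-- The `d_{x²-y²}` form factor in row coordinates: `ĝ_d(a, b) = cos(2πa/L) - cos(2πb/L)`. [folklore] -/
theorem dWaveGap_vecCons (a b : ZMod L) :
    dWaveGap ![a, b] = Real.cos (2 * π * (a.val : ℝ) / L) - Real.cos (2 * π * (b.val : ℝ) / L) := by
  simp only [dWaveGap, latticeMomentum, Matrix.cons_val_zero, Matrix.cons_val_one]

omit [NeZero L] in
/-- The band energy of the momentum `(a, b)` measured from `μ`, in row coordinates:
`ε_L(a,b) - μ = -2cos(2πa/L) + c_b`, `c_b = -2cos(2πb/L) - μ`. [folklore] -/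
theorem torusBand_vecCons_sub (a b : ZMod L) (μ : ℝ) :
    torusBand L ![a, b] - μ =
      -2 * Real.cos (2 * π * (a.val : ℝ) / L) + (-2 * Real.cos (2 * π * (b.val : ℝ) / L) - μ) := by
  rw [torusBand_two_eq]
  simp only [Matrix.cons_val_zero, Matrix.cons_val_one]
  ring

/-- **Every BdG mode gains**: `0 ≤ log((1 + cosh(β√(ξ²+D²)))/2) - log((1 + cosh(βξ))/2)` for `β ≥ 0`
(`√(ξ²+D²) ≥ |ξ|`, `cosh` is even and increasing on `[0,∞)`). [folklore] -/
theorem bdgModeGain_nonneg {β : ℝ} (hβ : 0 ≤ β) (ξ D : ℝ) :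
    0 ≤ Real.log ((1 + Real.cosh (β * Real.sqrt (ξ ^ 2 + D ^ 2))) / 2) -
        Real.log ((1 + Real.cosh (β * ξ)) / 2) := by
  have hξE : |ξ| ≤ Real.sqrt (ξ ^ 2 + D ^ 2) := by
    rw [← Real.sqrt_sq_eq_abs]
    exact Real.sqrt_le_sqrt (by nlinarith [sq_nonneg D])
  have hc : Real.cosh (β * ξ) ≤ Real.cosh (β * Real.sqrt (ξ ^ 2 + D ^ 2)) := by
    rw [Real.cosh_le_cosh, abs_mul, abs_mul, abs_of_nonneg hβ, abs_of_nonneg (Real.sqrt_nonneg _)]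
    exact mul_le_mul_of_nonneg_left hξE hβ
  have hpos : 0 < (1 + Real.cosh (β * ξ)) / 2 := by
    have := Real.one_le_cosh (β * ξ)
    positivity
  rw [sub_nonneg]
  exact Real.log_le_log hpos (by linarith)

/-- **The `d`-wave Cooper sum of the torus at the temperature cutoff.** Let `μ ∈ [-4 + 4s, -4s]`
(`s > 0`), `L ≥ 400/s²`, `β ≥ 128/s³`, `L ≥ β`, and let `G ≥ 0` on the momentum grid satisfy
`G(k) ≥ A ĝ_d(k)²/ξ_k` whenever `1/β < ξ_k ≤ s` (`ξ_k = ε_L(k) - μ`, `A ≥ 0`). Then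
`Σ_k G(k) ≥ A (s³/(256π²)) L² (log β - log(128/s³))`: at least `sL/(8π)` rows cross the Fermi level
transversally with `d`-wave margin `s` (`card_cooperGoodRows_dWave_ge`), along each the form factor is
`ĝ_d = c_b + μ/2 - ξ/2`, `|ĝ_d| ≥ s/2` on `0 < ξ ≤ s`, and the walk `cooperRow_weighted_sum_ge` collects
`(As²/4)(L/(8π))(log β - log(128/s³))`. [folklore] -/
theorem torus_dWaveWeighted_sum_ge {s μ β A : ℝ} (hs : 0 < s) (hμ1 : -4 + 4 * s ≤ μ)
    (hμ2 : μ ≤ -(4 * s)) (hL : 400 / s ^ 2 ≤ (L : ℝ)) (hβ : 128 / s ^ 3 ≤ β) (hLβ : β ≤ (L : ℝ))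
    (hA : 0 ≤ A) (G : TorusSite 2 L → ℝ) (hG0 : ∀ k, 0 ≤ G k)
    (hG : ∀ k, 1 / β < torusBand L k - μ → torusBand L k - μ ≤ s →
      A * dWaveGap k ^ 2 / (torusBand L k - μ) ≤ G k) :
    A * (s ^ 3 / (256 * π ^ 2)) * (L : ℝ) ^ 2 * (Real.log β - Real.log (128 / s ^ 3)) ≤
      ∑ k, G k := by
  have hπ := Real.pi_pos
  have hπ3 := Real.pi_gt_three
  have hs1 : s ≤ 1 := by linarith
  have hs2 : 0 < s ^ 2 := by positivity
  have hLr : (0 : ℝ) < L := lt_of_lt_of_le (by positivity) hL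
  have hsL : 400 ≤ s ^ 2 * L := by
    have h := (div_le_iff₀ hs2).1 hL
    linarith
  have hsL' : 32 * π ≤ s * L := by
    have h1 : s ^ 2 * L ≤ s * L := by
      have := mul_le_mul_of_nonneg_right (mul_le_of_le_one_left hs.le hs1) hLr.le
      simpa [sq] using this
    linarith [Real.pi_lt_d2]
  have hβpos : 0 < β := lt_of_lt_of_le (by positivity) hβ
  have hX : 0 ≤ Real.log β - Real.log (128 / s ^ 3) :=
    sub_nonneg.2 (Real.log_le_log (by positivity) hβ)
  -- the good rows
  set Gd : Finset ℕ := (Finset.range (L / 2 + 1)).filter fun n : ℕ =>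
      |2 * Real.cos (2 * π * (n : ℝ) / L) + μ| ≤ 2 - s ^ 2 / 2 ∧
        s ≤ |2 * Real.cos (2 * π * (n : ℝ) / L) + μ / 2| with hGd
  have hGdcard : 4 * s * L / (32 * π) ≤ (Gd.card : ℝ) :=
    card_cooperGoodRows_dWave_ge (d₀ := 4 * s) (by positivity) hμ1 hμ2 (by nlinarith) hs
      (by linarith) (by
        rw [div_le_iff₀ (by positivity)]
        linarith)
  have hGlt : ∀ n ∈ Gd, n < L := by
    intro n hn
    rw [hGd, Finset.mem_filter, Finset.mem_range] at hn
    have := Nat.pos_of_ne_zero (NeZero.ne L)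
    omega
  set GB : Finset (ZMod L) := Gd.image fun n : ℕ => (n : ZMod L) with hGB
  have hinj : Set.InjOn (fun n : ℕ => (n : ZMod L)) ↑Gd := by
    intro n hn m hm h
    have := congrArg ZMod.val h
    rwa [ZMod.val_cast_of_lt (hGlt n hn), ZMod.val_cast_of_lt (hGlt m hm)] at this
  have hGBcard : (GB.card : ℝ) = Gd.card := by
    rw [hGB, Finset.card_image_of_injOn hinj]
  -- one good row
  have hrow : ∀ b ∈ GB, A * (s ^ 2 / 4) * ((L : ℝ) / (8 * π)) * (Real.log β - Real.log (128 / s ^ 3)) ≤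
      ∑ a : ZMod L, G ![a, b] := by
    intro b hb
    rw [hGB, Finset.mem_image] at hb
    obtain ⟨nb, hnb, rfl⟩ := hb
    have hnbL := hGlt nb hnb
    obtain ⟨_, hgood1, hgood2⟩ := Finset.mem_filter.1 hnb
    have hvalb : ((nb : ZMod L)).val = nb := ZMod.val_cast_of_lt hnbL
    set c : ℝ := -2 * Real.cos (2 * π * (nb : ℝ) / L) - μ with hc
    have hc' : |c| ≤ 2 - s ^ 2 / 2 := by
      rw [hc, show -2 * Real.cos (2 * π * (nb : ℝ) / L) - μ =
        -(2 * Real.cos (2 * π * (nb : ℝ) / L) + μ) by ring, abs_neg]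
      exact hgood1
    have hcμ : s ≤ |c + μ / 2| := by
      rw [hc, show -2 * Real.cos (2 * π * (nb : ℝ) / L) - μ + μ / 2 =
        -(2 * Real.cos (2 * π * (nb : ℝ) / L) + μ / 2) by ring, abs_neg]
      exact hgood2
    have key := cooperRow_weighted_sum_ge (L := L) (φ := s) (A := A * (s ^ 2 / 4))
      (fun n : ℕ => -2 * Real.cos (2 * π * (n : ℝ) / L) + c)
      (fun n : ℕ => G ![((n : ℕ) : ZMod L), (nb : ZMod L)]) (fun _ => rfl) hs hs1 hc' hL hβ hLβ
      (by nlinarith) (by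
        rw [div_le_iff₀ hs]
        linarith) (by positivity) (fun _ => hG0 _) ?_
    · refine key.trans (le_of_eq ?_)
      refine Finset.sum_nbij (fun n : ℕ => (n : ZMod L)) (fun n _ => Finset.mem_univ _) ?_ ?_ ?_
      · intro n hn m hm h
        have hn' : n < L := by simpa using hn
        have hm' : m < L := by simpa using hm
        have := congrArg ZMod.val h
        rwa [ZMod.val_cast_of_lt hn', ZMod.val_cast_of_lt hm'] at this
      · intro a _
        exact ⟨a.val, by simpa using ZMod.val_lt a, ZMod.natCast_zmod_val a⟩
      · intro n _
        rfl
    · intro n hn h1 h2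
      show A * (s ^ 2 / 4) / (-2 * Real.cos (2 * π * (n : ℝ) / L) + c) ≤ G ![((n : ℕ) : ZMod L), (nb : ZMod L)]
      change 1 / β < -2 * Real.cos (2 * π * (n : ℝ) / L) + c at h1
      change -2 * Real.cos (2 * π * (n : ℝ) / L) + c ≤ s at h2
      have hval : ((n : ZMod L)).val = n := ZMod.val_cast_of_lt hn
      have hξ : torusBand L ![((n : ℕ) : ZMod L), (nb : ZMod L)] - μ =
          -2 * Real.cos (2 * π * (n : ℝ) / L) + c := by
        rw [torusBand_vecCons_sub, hval, hvalb]
      have hgap : dWaveGap ![((n : ℕ) : ZMod L), (nb : ZMod L)] =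
          (c + μ / 2) - (-2 * Real.cos (2 * π * (n : ℝ) / L) + c) / 2 := by
        rw [dWaveGap_vecCons, hval, hvalb, hc]
        ring
      have hgpos : 0 < -2 * Real.cos (2 * π * (n : ℝ) / L) + c := lt_trans (by positivity) h1
      have hgap2 : s ^ 2 / 4 ≤ dWaveGap ![((n : ℕ) : ZMod L), (nb : ZMod L)] ^ 2 := by
        have h3 : s / 2 ≤ |dWaveGap ![((n : ℕ) : ZMod L), (nb : ZMod L)]| := by
          rw [hgap]
          have h4 := abs_sub_abs_le_abs_sub (c + μ / 2) ((-2 * Real.cos (2 * π * (n : ℝ) / L) + c) / 2)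
          rw [abs_of_pos (half_pos hgpos)] at h4
          linarith
        have h5 : (s / 2) ^ 2 ≤ |dWaveGap ![((n : ℕ) : ZMod L), (nb : ZMod L)]| ^ 2 :=
          pow_le_pow_left₀ (by positivity) h3 2
        rw [sq_abs] at h5
        linarith
      have hGk := hG ![((n : ℕ) : ZMod L), (nb : ZMod L)] (by rw [hξ]; exact h1) (by rw [hξ]; exact h2)
      rw [hξ] at hGk
      refine le_trans ?_ hGk
      have h6 := div_le_div_of_nonneg_right hgap2 hgpos.le
      calc A * (s ^ 2 / 4) / (-2 * Real.cos (2 * π * (n : ℝ) / L) + c)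
          = A * (s ^ 2 / 4 / (-2 * Real.cos (2 * π * (n : ℝ) / L) + c)) := mul_div_assoc _ _ _
        _ ≤ A * (dWaveGap ![((n : ℕ) : ZMod L), (nb : ZMod L)] ^ 2 /
              (-2 * Real.cos (2 * π * (n : ℝ) / L) + c)) := mul_le_mul_of_nonneg_left h6 hA
        _ = _ := (mul_div_assoc _ _ _).symm
  -- assembly over the rows
  have hunit : 0 ≤ A * (s ^ 2 / 4) * ((L : ℝ) / (8 * π)) * (Real.log β - Real.log (128 / s ^ 3)) := by
    positivity
  calc A * (s ^ 3 / (256 * π ^ 2)) * (L : ℝ) ^ 2 * (Real.log β - Real.log (128 / s ^ 3))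
      = 4 * s * L / (32 * π) *
          (A * (s ^ 2 / 4) * ((L : ℝ) / (8 * π)) * (Real.log β - Real.log (128 / s ^ 3))) := by
        field_simp
        ring
    _ ≤ (GB.card : ℝ) *
          (A * (s ^ 2 / 4) * ((L : ℝ) / (8 * π)) * (Real.log β - Real.log (128 / s ^ 3))) := by
        rw [hGBcard]
        exact mul_le_mul_of_nonneg_right hGdcard hunit
    _ = ∑ b ∈ GB, A * (s ^ 2 / 4) * ((L : ℝ) / (8 * π)) * (Real.log β - Real.log (128 / s ^ 3)) := by
        rw [Finset.sum_const, nsmul_eq_mul]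
    _ ≤ ∑ b ∈ GB, ∑ a : ZMod L, G ![a, b] := Finset.sum_le_sum hrow
    _ ≤ ∑ b : ZMod L, ∑ a : ZMod L, G ![a, b] :=
        Finset.sum_le_sum_of_subset_of_nonneg (Finset.subset_univ _) fun b _ _ =>
          Finset.sum_nonneg fun a _ => hG0 _
    _ = ∑ k, G k := (sum_torusSite_two_eq G).symm

end Geometry

/-! ### The stub -/

/-- **Stub (F) of line `entropy-staircase-linear-regime`: the free linear-regime Cooper logarithm.**
For every compact `[μ₁, μ₂] ⊂ (-4, 0)` there are `c₀, C₀ > 0` such that for all `β ≥ 1`,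
`μ ∈ [μ₁, μ₂]`, eventually in `L` (threshold depending on `β`) and all `|h| ≤ 1/β`:
`c₀ h² log β - C₀ h² ≤ p̃_L(β,0,μ,h) - p̃_L(β,0,μ,0)` for the `U = 0` `d`-wave-sourced Hubbard torus,
`p̃_L(β,0,μ,h) = log Re Z_β(dWaveSourceTorus L 0 μ h)/(βL²)`. [folklore] -/
theorem stub_freeLinearCooperLog :
    ∀ μ₁ μ₂ : ℝ, -4 < μ₁ → μ₁ ≤ μ₂ → μ₂ < 0 → ∃ c₀ C₀ : ℝ, 0 < c₀ ∧ 0 < C₀ ∧ ∀ β : ℝ, 1 ≤ β →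
      ∀ μ ∈ Set.Icc μ₁ μ₂, ∃ L₀ : ℕ, ∀ (L : ℕ) [NeZero L], L₀ ≤ L → ∀ h : ℝ, |h| ≤ 1 / β →
      c₀ * h ^ 2 * Real.log β - C₀ * h ^ 2 ≤
        Real.log (Matrix.partitionFn β (Literature.MathematicalPhysics.QuantumLattice.dWaveSourceTorus L 0 μ h)).re / (β * (L : ℝ) ^ 2) -
        Real.log (Matrix.partitionFn β (Literature.MathematicalPhysics.QuantumLattice.dWaveSourceTorus L 0 μ 0)).re / (β * (L : ℝ) ^ 2) := by
  intro μ₁ μ₂ h4 h12 h0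
  obtain ⟨s, hsdef⟩ : ∃ s : ℝ, s = min (μ₁ + 4) (-μ₂) / 4 := ⟨_, rfl⟩
  have hmin : 0 < min (μ₁ + 4) (-μ₂) := lt_min (by linarith) (by linarith)
  have hs : 0 < s := by rw [hsdef]; positivity
  have hminl := min_le_left (μ₁ + 4) (-μ₂)
  have hminr := min_le_right (μ₁ + 4) (-μ₂)
  have hs1 : s ≤ 1 := by rw [hsdef]; linarith
  have hs3 : 0 < s ^ 3 := by positivity
  have hs2le : s ^ 2 ≤ 1 := pow_le_one₀ hs.le hs1
  have hs3le : s ^ 3 ≤ 1 := pow_le_one₀ hs.le hs1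
  have h128 : 1 < 128 / s ^ 3 := by
    rw [lt_div_iff₀ hs3]
    linarith
  have hlog128 : 0 < Real.log (128 / s ^ 3) := Real.log_pos h128
  have hπ := Real.pi_pos
  refine ⟨s ^ 3 / (1280 * π ^ 2), s ^ 3 / (1280 * π ^ 2) * Real.log (128 / s ^ 3), by positivity,
    by positivity, ?_⟩
  intro β hβ μ hμ
  have hβ0 : 0 < β := by linarith
  have hμ1 : -4 + 4 * s ≤ μ := by rw [hsdef]; linarith [hμ.1]
  have hμ2 : μ ≤ -(4 * s) := by rw [hsdef]; linarith [hμ.2]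
  refine ⟨max ⌈400 / s ^ 2⌉₊ ⌈β⌉₊, fun L _ hL h hh => ?_⟩
  have hL400 : 400 / s ^ 2 ≤ (L : ℝ) := Nat.ceil_le.mp (le_of_max_le_left hL)
  have hLβ : β ≤ (L : ℝ) := Nat.ceil_le.mp (le_of_max_le_right hL)
  have hLpos : (0 : ℝ) < L := by exact_mod_cast Nat.pos_of_ne_zero (NeZero.ne L)
  have hβL : 0 < β * (L : ℝ) ^ 2 := by positivity
  by_cases hβs : 128 / s ^ 3 ≤ β
  · -- the Cooper regime `β ≥ 128/s³`
    have hL3 : 3 ≤ L := by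
      have h1 : (400 : ℝ) ≤ 400 / s ^ 2 := by
        rw [le_div_iff₀ (by positivity)]
        linarith
      have : (3 : ℝ) ≤ L := by linarith
      exact_mod_cast this
    rw [← sub_div, le_div_iff₀ hβL, log_partitionFn_dWaveSourceTorus_zero_sub hL3]
    have hh2 : h ^ 2 ≤ (1 / β) ^ 2 := by
      rw [← sq_abs h]
      exact pow_le_pow_left₀ (abs_nonneg h) hh 2
    have key := torus_dWaveWeighted_sum_ge (L := L) (A := β * h ^ 2 / 5) hs hμ1 hμ2 hL400 hβs hLβ
      (by positivity)
      (fun k => Real.log ((1 + Real.cosh (β * Real.sqrt ((torusBand L k - μ) ^ 2 +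
          (2 * Real.sqrt 2 * h * dWaveGap k) ^ 2))) / 2) -
        Real.log ((1 + Real.cosh (β * (torusBand L k - μ))) / 2))
      (fun k => bdgModeGain_nonneg hβ0.le _ _) ?_
    · refine le_trans (le_of_eq ?_) key
      field_simp
      ring
    · intro k h1 h2
      have hξpos : 0 < torusBand L k - μ := lt_trans (by positivity) h1
      have hξabs : |torusBand L k - μ| = torusBand L k - μ := abs_of_pos hξpos
      have h1' : 1 < β * (torusBand L k - μ) := by
        rw [div_lt_iff₀ hβ0] at h1
        linarith
      have hβξ : 1 ≤ β * |torusBand L k - μ| := by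
        rw [hξabs]
        exact h1'.le
      have hg2 : dWaveGap k ^ 2 ≤ 4 := by
        have h3 := abs_dWaveGap_le_two k
        have h5 : |dWaveGap k| ^ 2 ≤ 2 ^ 2 := pow_le_pow_left₀ (abs_nonneg _) h3 2
        rw [sq_abs] at h5
        linarith
      have hD : (2 * Real.sqrt 2 * h * dWaveGap k) ^ 2 = 8 * h ^ 2 * dWaveGap k ^ 2 := by
        rw [mul_pow, mul_pow, mul_pow, Real.sq_sqrt zero_le_two]
        ring
      have hβinv : (1 / β) ^ 2 ≤ (torusBand L k - μ) ^ 2 :=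
        pow_le_pow_left₀ (by positivity) h1.le 2
      have hhξ : h ^ 2 ≤ (torusBand L k - μ) ^ 2 := hh2.trans hβinv
      have hh0 : 0 ≤ h ^ 2 := sq_nonneg h
      have hD1 : (2 * Real.sqrt 2 * h * dWaveGap k) ^ 2 ≤ 35 * (torusBand L k - μ) ^ 2 := by
        rw [hD]
        have := mul_le_mul hhξ hg2 (sq_nonneg _) (sq_nonneg _)
        linarith
      have hD2 : β * (2 * Real.sqrt 2 * h * dWaveGap k) ^ 2 ≤ 35 * |torusBand L k - μ| := by
        rw [hD, hξabs]
        have h3 : β * h ^ 2 ≤ 1 / β := by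
          calc β * h ^ 2 ≤ β * (1 / β) ^ 2 := mul_le_mul_of_nonneg_left hh2 hβ0.le
            _ = 1 / β := by field_simp
        have h6 : β * h ^ 2 * dWaveGap k ^ 2 ≤ (1 / β) * 4 :=
          mul_le_mul h3 hg2 (sq_nonneg _) (by positivity)
        linarith
      have hmode := bdgModeGain_ge hβ0 hβξ hD1 hD2
      refine le_trans (le_of_eq ?_) hmode
      rw [hD, hξabs]
      field_simp
      ring
  · -- the trivial regime `β < 128/s³`: the response is `≥ 0`
    push Not at hβs
    have hnn := TwSourcedCondensation.Negative.pressure_response_nonneg L hβ0.le 0 μ h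
    have hlogle : Real.log β ≤ Real.log (128 / s ^ 3) := Real.log_le_log hβ0 hβs.le
    have h2 : 0 ≤ s ^ 3 / (1280 * π ^ 2) * h ^ 2 := by positivity
    have h3 := mul_le_mul_of_nonneg_left hlogle h2
    linarith

end Summit.HubbardSuperconductivity.HubbardSuperconductivity.Theorems
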